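import Literature.Analysis.FluidPDE.SmoothL2FieldCalculus
import Literature.Analysis.FluidPDE.CheskidovShvydkoyBlockTime
import HarnessLib

/-!
# The block energy identity of Cheskidov–Shvydkoy's Lemma 3.2 on an interval of regularity

Analysis/FluidPDE support file (serves the discharge of
`Literature.Analysis.FluidPDE.cheskidov_shvydkoy`, ns.S31). Cheskidov and Shvydkoy prove their
Lemma 3.2 (Arch. Ration. Mech. Anal. 195 (2010); arXiv:0708.3067, p. 5) from the frequency-localised
energy balance (8): "Let `(α, β) ⊂ (0,T]` be an interval of regularity … use the weak formulation
of the NSE with the test-function `λ_q^{1+ε}(u_q)_q`. Then on `(α, β)` we obtain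
`½ d/dt λ_q^{1+ε}‖u_q‖²₂ + ν λ_q^{3+ε}‖u_q‖²₂ ≤ λ_q^{1+ε} ∫ Tr[(u ⊗ u)_q · ∇u_q] dx`". This file
**proves** the exact identity behind (8) for a classical solution on a compact sub-slab of an
interval of regularity (`IsSmoothSlabSolution`: classical solution of the unforced system on
`[t₁, t₂]`, velocity a regular slab, velocity and pressure slices smooth `L²` fields — the
properties of Leray's regular solutions, Ożański–Pooley 2018, Cor. 6.16), in integrated form and
before any weighting in `q`:

`‖Δ̇_j v(t)‖²₂ - ‖Δ̇_j v(s)‖²₂ = 2 ∫ₛᵗ ( -ν ∑_i ‖∂_i Δ̇_j v‖²₂ - ∫ ⟪Δ̇_j v, Δ̇_j ((v·∇)v)⟫ ) dτ`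
(`IsSmoothSlabSolution.blockEnergy_eq`), from

* the kinematic identity `‖Δ̇_j v(t)‖² - ‖Δ̇_j v(s)‖² = 2∫∫⟪Δ̇_j v, Δ̇_j ∂ₜv⟫`
  (`CheskidovShvydkoyBlockTime.lean`) and the momentum equation `∂ₜv = νΔv - (v·∇)v - ∇p`;
* the pressure drops out: `∫ ⟪Δ̇_j u, Δ̇_j ∇P⟫ = 0` (`integral_inner_blockFn_gradient_eq_zero`:
  `Δ̇_j ∇ = ∇ Δ̇_j`, integration by parts, `div Δ̇_j u = Δ̇_j div u = 0`);
* the viscous term: `∫ ⟪Δ̇_j u, Δ̇_j Δu⟫ = -∑_i ‖∂_i Δ̇_j u‖²₂` (`integral_inner_blockFn_laplacian`: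
  `Δ̇_j Δ = Δ Δ̇_j` and Green's identity), both from `SmoothL2FieldCalculus.lean`.

The nonlinear term `∫ ⟪Δ̇_j v, Δ̇_j ((v·∇)v)⟫` (CS's `∫ Tr[(u ⊗ u)_q · ∇u_q]` after an integration by
parts) is left untouched here; its paraproduct estimate is the next file.

## References

* A. Cheskidov, R. Shvydkoy, Arch. Ration. Mech. Anal. 195 (2010) 159–169 = arXiv:0708.3067,
  proof of Lemma 3.2, (8), p. 5. [CheskidovShvydkoy2010]
* W. S. Ożański, B. C. Pooley, in: PDE in Fluid Mechanics, LMS LN 452, CUP 2018, Cor. 6.16,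
  Thm. 6.17. [OzanskiPooley2018]
-/

noncomputable section

open MeasureTheory Filter Topology Function Set
open Literature.Analysis.FunctionSpaces
open scoped ENNReal NNReal RealInnerProductSpace Laplacian

namespace Literature.Analysis.FluidPDE

section Slice

variable {E : Type*} [NormedAddCommGroup E] [InnerProductSpace ℝ E] [FiniteDimensional ℝ E]
  [MeasurableSpace E] [BorelSpace E]

/-- The block of a divergence-free smooth bounded field is divergence free. [folklore] -/
theorem _root_.Literature.Analysis.FunctionSpaces.HasBoundedDerivs.isDivFree_blockFn {u : E → E}
    (hu : HasBoundedDerivs u) (hdiv : VectorCalculus.IsDivFree u) (j : ℤ) :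
    VectorCalculus.IsDivFree (blockFn j u) := by
  intro x
  rw [hu.divergence_blockFn j]
  have h0 : VectorCalculus.divergence u = (0 : E → ℝ) := funext hdiv
  rw [h0, blockFn_zero]
  rfl

/-- **The pressure drops out of the block energy balance**: `∫ ⟪Δ̇_j u, Δ̇_j ∇P⟫ = 0` for a
divergence-free smooth `L²` field `u` and a smooth `L²` scalar `P` (`Δ̇_j ∇P = ∇ Δ̇_j P`, integrate by
parts, `div Δ̇_j u = Δ̇_j div u = 0`; Cheskidov–Shvydkoy test the weak formulation with the
divergence-free field `(u_q)_q`, arXiv:0708.3067 p. 5). [folklore] -/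
theorem integral_inner_blockFn_gradient_eq_zero {u : E → E} (hu : IsSmoothL2Field u)
    (hdiv : VectorCalculus.IsDivFree u) {P : E → ℝ} (hP : IsSmoothL2Field P) (j : ℤ) :
    ∫ x, ⟪blockFn j u x, blockFn j (gradient P) x⟫ = 0 := by
  rw [hP.blockFn_gradient j, (hu.blockFn j).integral_inner_gradient (hP.blockFn j)]
  have h0 : ∀ x, VectorCalculus.divergence (blockFn j u) x = 0 := hu.isDivFree_blockFn hdiv j
  simp [h0]

/-- **The viscous term of the block energy balance**: `∫ ⟪Δ̇_j u, Δ̇_j Δu⟫ = -∑_i ∫ ‖∂_i Δ̇_j u‖²`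
(`Δ̇_j Δ = Δ Δ̇_j` and Green's identity; CS (8): `ν λ_q² ‖u_q‖²`-type dissipation). [folklore] -/
theorem integral_inner_blockFn_laplacian {u : E → E} (hu : IsSmoothL2Field u) (j : ℤ) :
    ∫ x, ⟪blockFn j u x, blockFn j (Δ u) x⟫ =
      -∑ i, ∫ x, ‖fderiv ℝ (blockFn j u) x (stdOrthonormalBasis ℝ E i)‖ ^ 2 := by
  rw [← hu.laplacian_blockFn j]
  exact (hu.blockFn j).integral_inner_laplacian

/-- **The block energy balance at a fixed time** (the dynamic content of Cheskidov–Shvydkoy's (8)).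
Let `u` be a divergence-free smooth `L²` field, `P` a smooth `L²` scalar and
`a = νΔu - (u·∇)u - ∇P` (the Navier–Stokes time derivative). Then
`∫ ⟪Δ̇_j u, Δ̇_j a⟫ = -ν (∑_i ‖∂_i Δ̇_j u‖²₂) - ∫ ⟪Δ̇_j u, Δ̇_j ((u·∇)u)⟫`. [folklore] -/
theorem integral_inner_blockFn_ns_rhs {u : E → E} (hu : IsSmoothL2Field u) (hdiv : VectorCalculus.IsDivFree u)
    {P : E → ℝ} (hP : IsSmoothL2Field P) {ν : ℝ} {a : E → E}
    (ha : ∀ x, a x = ν • (Δ u) x - convect u u x - gradient P x) (j : ℤ) :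
    ∫ x, ⟪blockFn j u x, blockFn j a x⟫ =
      -ν * (∑ i, ∫ x, ‖fderiv ℝ (blockFn j u) x (stdOrthonormalBasis ℝ E i)‖ ^ 2) -
        ∫ x, ⟪blockFn j u x, blockFn j (convect u u) x⟫ := by
  haveI : Fact (1 ≤ (2 : ℝ≥0∞)) := ⟨one_le_two⟩
  have hL : IsSmoothL2Field (Δ u) := hu.laplacian
  have hC : IsSmoothL2Field (convect u u) := hu.convect hu.toHasBoundedDerivs
  have hG : IsSmoothL2Field (gradient P) := hP.gradient
  have haeq : a = (ν • Δ u - convect u u) - gradient P := by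
    funext x; simp only [ha, Pi.sub_apply, Pi.smul_apply]
  have hblock : blockFn j a = ν • blockFn j (Δ u) - blockFn j (convect u u) - blockFn j (gradient P) := by
    rw [haeq, blockFn_sub j ((hL.memLp_two.const_smul ν).sub hC.memLp_two) hG.memLp_two,
      blockFn_sub j (hL.memLp_two.const_smul ν) hC.memLp_two, blockFn_smul]
  set w := blockFn j u with hw
  have hwS : IsSmoothL2Field w := hu.blockFn j
  have i1 : Integrable (fun x => ⟪w x, blockFn j (Δ u) x⟫) volume :=
    integrable_inner_of_memLp_two hwS.memLp_two (hL.blockFn j).memLp_two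
  have i2 : Integrable (fun x => ⟪w x, blockFn j (convect u u) x⟫) volume :=
    integrable_inner_of_memLp_two hwS.memLp_two (hC.blockFn j).memLp_two
  have i3 : Integrable (fun x => ⟪w x, blockFn j (gradient P) x⟫) volume :=
    integrable_inner_of_memLp_two hwS.memLp_two (hG.blockFn j).memLp_two
  have hpt : ∀ x, ⟪w x, blockFn j a x⟫ = ν * ⟪w x, blockFn j (Δ u) x⟫ - ⟪w x, blockFn j (convect u u) x⟫ -
      ⟪w x, blockFn j (gradient P) x⟫ := by
    intro x
    rw [hblock]
    simp only [Pi.sub_apply, Pi.smul_apply, inner_sub_right, inner_smul_right]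
  simp_rw [hpt]
  have e1 : ∫ x, (ν * ⟪w x, blockFn j (Δ u) x⟫ - ⟪w x, blockFn j (convect u u) x⟫ - ⟪w x, blockFn j (gradient P) x⟫) =
      (∫ x, (ν * ⟪w x, blockFn j (Δ u) x⟫ - ⟪w x, blockFn j (convect u u) x⟫)) -
        ∫ x, ⟪w x, blockFn j (gradient P) x⟫ := integral_sub ((i1.const_mul ν).sub i2) i3
  have e2 : ∫ x, (ν * ⟪w x, blockFn j (Δ u) x⟫ - ⟪w x, blockFn j (convect u u) x⟫) =
      (∫ x, ν * ⟪w x, blockFn j (Δ u) x⟫) - ∫ x, ⟪w x, blockFn j (convect u u) x⟫ :=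
    integral_sub (i1.const_mul ν) i2
  rw [e1, e2, MeasureTheory.integral_const_mul, integral_inner_blockFn_gradient_eq_zero hu hdiv hP j, sub_zero, hw,
    integral_inner_blockFn_laplacian hu j]
  ring

end Slice

/-! ## Along a classical solution on a regular slab -/

section Slab

variable {E : Type*} [NormedAddCommGroup E] [InnerProductSpace ℝ E] [FiniteDimensional ℝ E]
  [MeasurableSpace E] [BorelSpace E]

/-- A **smooth slab solution**: a classical solution `(v, p)` of the unforced Navier–Stokes
equations on the closed time set `[t₁, t₂]` whose velocity is a regular slab (jointly smooth,
`v, ∂ₜv` bounded and in `L²` uniformly) and whose velocity and pressure slices are smooth `L²`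
fields — a compact sub-slab of an interval of regularity of a Leray–Hopf solution
(Ożański–Pooley 2018, Cor. 6.16; Cheskidov–Shvydkoy 2010, p. 5: "Let `(α, β) ⊂ (0,T]` be an
interval of regularity"). [folklore] -/
structure IsSmoothSlabSolution (t₁ t₂ ν : ℝ) (v : ℝ → E → E) (p : ℝ → E → ℝ) : Prop where
  /-- `(v, p)` is a classical solution of the unforced system on `[t₁, t₂]`. -/
  ns : IsClassicalNSSolutionOn (Icc t₁ t₂) ν 0 v p
  /-- `v` is a regular slab. -/
  regular : IsRegularSlab t₁ t₂ v
  /-- the velocity slices are smooth `L²` fields. -/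
  smooth_slice : ∀ t ∈ Icc t₁ t₂, IsSmoothL2Field (v t)
  /-- the pressure slices are smooth `L²` fields. -/
  smooth_pressure : ∀ t ∈ Icc t₁ t₂, IsSmoothL2Field (p t)

/-- **The block energy identity along a classical solution** (Cheskidov–Shvydkoy 2010, proof of
Lemma 3.2, (8), in integrated form on an interval of regularity): for a smooth slab solution on
`[t₁, t₂]` and `t₁ ≤ s ≤ t ≤ t₂`,
`‖Δ̇_j v(t)‖²₂ - ‖Δ̇_j v(s)‖²₂ = 2 ∫ₛᵗ ( -ν ∑_i ‖∂_i Δ̇_j v(τ)‖²₂ - ∫ ⟪Δ̇_j v(τ), Δ̇_j ((v·∇)v)(τ)⟫ ) dτ`.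
[cite: CheskidovShvydkoy2010, Lemma 3.2 (proof, (8))] -/
theorem IsSmoothSlabSolution.blockEnergy_eq {t₁ t₂ ν : ℝ} {v : ℝ → E → E} {p : ℝ → E → ℝ}
    (h : IsSmoothSlabSolution t₁ t₂ ν v p) (j : ℤ) {s t : ℝ} (hs : t₁ ≤ s) (hst : s ≤ t) (ht : t ≤ t₂) :
    (∫ x, ‖blockFn j (v t) x‖ ^ 2) - ∫ x, ‖blockFn j (v s) x‖ ^ 2 =
      2 * ∫ τ in s..t, (-ν * (∑ i, ∫ x, ‖fderiv ℝ (blockFn j (v τ)) x (stdOrthonormalBasis ℝ E i)‖ ^ 2) -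
        ∫ x, ⟪blockFn j (v τ) x, blockFn j (convect (v τ) (v τ)) x⟫) := by
  rw [h.regular.integral_norm_blockFn_sq_sub_eq j hs hst ht]
  congr 1
  refine intervalIntegral.integral_congr fun τ hτ => ?_
  have hτ' : τ ∈ Icc t₁ t₂ := by
    rw [uIcc_of_le hst] at hτ
    exact ⟨hs.trans hτ.1, hτ.2.trans ht⟩
  refine integral_inner_blockFn_ns_rhs (h.smooth_slice τ hτ') (h.ns.divFree τ hτ') (h.smooth_pressure τ hτ')
    (ν := ν) (fun x => ?_) j
  have hm := h.ns.momentum τ hτ' x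
  simp only [Pi.zero_apply, add_zero] at hm
  rw [eq_sub_iff_add_eq.2 hm]
  abel

end Slab

end Literature.Analysis.FluidPDE

end
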